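import Summits.BirchSwinnertonDyer.BirchSwinnertonDyer.Theorems.PrintCf2SplitBadTwoCMConjugationSwapCount
import Summits.BirchSwinnertonDyer.BirchSwinnertonDyer.Theorems.SylvesterTwoHeegnerIndexShaConjugation
import Summits.BirchSwinnertonDyer.BirchSwinnertonDyer.Theorems.CMKolyvaginAtInertTwoInertOrderSplittingH1
import Literature.NumberTheory.EllipticCurves.ShaIsogenyProofs
import Literature.NumberTheory.EllipticCurves.SemilinearTateDual
import Literature.NumberTheory.EllipticCurves.IsogenyGeomEndRingProofs
import Literature.NumberTheory.EllipticCurves.IsogenyGeomEndRingQuadraticProofs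
import Literature.NumberTheory.EllipticCurves.IsogenyHomProofs
import HarnessLib

/-!
# Crux `PrintCf2.SplitBadTwoRankOneOfFacts` (item stmt-BirchSwinnertonDyer-20368), road α over the CM field:
# `Ш(E/K)[2^∞]` as a `ℤ[π]⟨τ⟩`-module — the CM endomorphism `π` and a lift `τ` of `σ ∈ Aut(K/ℚ)` acting on the
# TREE's Tate–Shafarevich group, and the SWAP COUNT `ord₂ #Ш(E/K)[2^∞] = 2 · ord₂ #Ш(E/K)[𝔭^∞]` when `τ π = π̄ τ`

Cell `bsd-print-cf2`, width seat `bsd-line-cf2-p1-w8` g0 (planner WIDTH BRICK MENU 16:11:50Z, brick **B6**, first half);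
`--supports stmt-BirchSwinnertonDyer-20368` (helper). HONEST FRAMING: nothing here closes a crux or a stub; BSD is not proved by
any of this; no summit statement is proved by this seat. No definition is introduced. beyond-print theorem: no (bookkeeping on
the tree's `Ш`).

SETTING. `E = W/ℚ` a Weierstrass curve, `K` a number field, `V = W_K = W.baseChange K`; `π ∈ End_{K̄}(V)` (`WeierstrassCurve.
geomEndRing`) commuting with `Γ_K` (`π ∈ End_K(V)`) with `π² = π − 2` — the complex multiplication `[(1 + √−7)/2]` of a curve with
`j = −3375` over `K ∋ √−7` (-w2 g7: `CMPrimes.exists_cmPrimaryDecomposition_two`, `cmEndo_mem_endRing_of_sq_eq_neg_seven`);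
`r ∈ ℤ₂` a root of `X² − X + 2`; `M := Ш(V/K)[2^∞]` = `AddCommGroup.primaryComponent ↥V.sha 2` of the tree's `WeierstrassCurve.sha`.

* §1 `exists_isogeny_apply_eq_cmEndo` — such a `π` IS an endo-isogeny `φ` of `V` over `K` in the tree's sense (`WeierstrassCurve.
  Isogeny`: algebraic by the PROVED `mem_geomEndRing_iff_holds`, `π ≠ 0` in the characteristic-zero ring `End_{K̄}(V)`; finite kernel
  by `IsAlgebraicOn.finite_ker`), acting as `π` on `V(K̄)` and with `φ(φP) = φP − 2P`; every isogeny has local points maps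
  (`Isogeny.hasLocalPointsMaps_toAddMonoidHom`, PROVED), so `Ш(φ)` (`Literature.NumberTheory.EllipticCurves.shaMap`) is available.
  From §2 on everything is phrased for an endo-isogeny `φ` with `φ(φP) = φP − 2P` (no ring structure needed).
* §2 `galH1Map_galH1Map_cmEndo`, `exists_shaPi_two` — `H¹(φ)² = H¹(φ) − 2` on `H¹(K, E)` and `Ш(φ)` restricted to `M`: an additive
  `πM : M →+ M` lying over `H¹(φ) = galH1Map φ` with `πM(πM x) = πM x − 2x` (cmk2 g10's `InertOrderSplittingH1.resH1Hom_id_rel`: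
  polynomial relations pass to `H¹`).
* §3 `exists_conj_addEquiv_sha_two`, `galH1Map_conjH1Points_of_anti` — for `σ ∈ Aut(K/ℚ)` with a lift `τ` to `K̄` (`IsLiftOfAut`),
  all infinite places of `K` complex: `τ_*` (`IsLiftOfAut.conjH1Points`, `Ш`-stable by `SylvesterTwoShaConjugation.conjH1Points_mem_sha`)
  restricts to an additive AUTOMORPHISM `g : M ≃+ M` (inverse `(τ⁻¹)_*`, the tree's `IsLiftOfAut.symm_isLiftOfAut`: `conjH1Points_symm_conjH1Points`); and if
  `φ (τ Q) = τ Q − τ (φ Q)` on `V(K̄)` (`τ` conjugates `φ` to `φ̄ = 1 − φ`), then `H¹(φ) τ_* = τ_* − τ_* H¹(φ)` (cmk2's `resH1Hom_anti`).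
* §4 **`card_sha_two_primary_eq_sq_of_lift` / `padicValNat_card_sha_two_primary_eq_two_mul_of_lift`** — in that situation, for
  the eigen-subgroups `C = Ш[𝔭^∞]` (`Ш(π)` acts as `r`) and `C' = Ш[𝔭̄^∞]` (`Ш(π)` acts as `1 − r`) of `M` — membership in -w2 g7's
  integer-approximation currency, read on `H¹(K, E)` — one has `#C = #C'`, **`#Ш(V/K)[2^∞] = (#Ш[𝔭^∞])²`** and
  **`ord₂ #Ш(V/K)[2^∞] = 2 · ord₂ #Ш[𝔭^∞] = 2 · ord₂ #Ш[𝔭̄^∞]`** (`Nat.card`; no finiteness of `Ш` assumed — both sides read `0`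
  on an infinite `M`), by this seat's B4 `CMPrimes.natCard_eq_sq_of_antiEquiv` (p648048).
The EXISTENCE of such a conjugating lift (for `K/ℚ` Galois: the `K̄`-transport of -w2 g7's `π`-conjugating element of `Γ_ℚ`,
`exists_conj_cmEndo_eq_one_sub`) is the companion file `PrintCf2SplitBadTwoCMShaConjugationSwap`.

References: B. H. Gross, LMS LNS 153 (1991) §5 (5.1) (`Gal(K/ℚ)` acting on `Ш(E/K)`); K. Rubin, LNM 1716 (1999) §2; J. S. Milne,
*Arithmetic Duality Theorems*, I.§6–7 (`Ш(f)`); J.-P. Serre, *Galois Cohomology*, I.§2.4 (compatible pairs).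
-/

noncomputable section

open scoped Classical

set_option linter.dupNamespace false
set_option autoImplicit false

namespace Summit.BirchSwinnertonDyer.BirchSwinnertonDyer.Theorems.PrintCf2.CMPrimes

open WeierstrassCurve Literature.NumberTheory.EllipticCurves Literature.NumberTheory.GaloisRepresentations Field NumberField
open Summit.BirchSwinnertonDyer.BirchSwinnertonDyer.Theorems

/-! ## §1 `π` is an endo-isogeny over `K` -/

section Isogeny

variable {K : Type} [Field K] (V : WeierstrassCurve K) [V.IsElliptic]

/-- **An element of `End_K(E)` with `π² = π − 2` is an endo-isogeny over `K`** (tree currency `WeierstrassCurve.Isogeny`): it is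
non-zero (else `2 = 0` in the characteristic-zero ring `End_{K̄}(E)`, `charZero_geomEndRing`), hence ALGEBRAIC by the proved
`mem_geomEndRing_iff_holds`, `Γ_K`-equivariant by hypothesis, and of finite kernel (`IsAlgebraicOn.finite_ker`). The isogeny `φ`
acts as `π` on `E(K̄)` and inherits `φ(φP) = φP − 2P` (`cmEndo_apply_apply`). Every isogeny has local points maps (PROVED,
`Isogeny.hasLocalPointsMaps_toAddMonoidHom`), so `Ш(φ)` (`Literature.NumberTheory.EllipticCurves.shaMap`) is available.
[cite: SilvermanAEC2009, III.4 (Hom(E₁, E₂), End(E)) and Thm. III.4.8] -/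
theorem exists_isogeny_apply_eq_cmEndo {π : AddMonoid.End V.geomPoints} (hπ : π ∈ V.geomEndRing)
    (hπG : ∀ (g : absoluteGaloisGroup K) (P : V.geomPoints), π (g • P) = g • π P) (hrel : π * π = π - 2) :
    ∃ φ : Isogeny V V, (∀ P, φ P = π P) ∧ ∀ P, φ (φ P) = φ P - 2 • P := by
  have hπ0 : π ≠ 0 := by
    intro h0
    haveI := charZero_geomEndRing V
    have h2 : ((⟨π, hπ⟩ : V.geomEndRing) : V.geomEndRing) * ⟨π, hπ⟩ = ⟨π, hπ⟩ - 2 :=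
      Subtype.ext (by push_cast; exact hrel)
    have : (⟨π, hπ⟩ : V.geomEndRing) = 0 := Subtype.ext h0
    rw [this, mul_zero, zero_sub, eq_comm, neg_eq_zero] at h2
    exact two_ne_zero h2
  have halg : IsAlgebraicOn V V π := ((mem_geomEndRing_iff_holds V π).mp hπ).resolve_left hπ0
  let f : V.geomPoints →+ V.geomPoints :=
    { toFun := fun P ↦ π P, map_zero' := map_zero π, map_add' := map_add π }
  have hf : ∀ P, f P = π P := fun _ ↦ rfl
  have halgf : IsAlgebraicOn V V f := halg
  refine ⟨{ toAddMonoidHom := f, isAlgebraic := halgf, equivariant := fun g P ↦ ?_,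
            finite_ker := halgf.finite_ker }, fun _ ↦ rfl, fun P ↦ ?_⟩
  · rw [hf, hf, hπG]
  · change f (f P) = f P - 2 • P
    rw [hf, hf, cmEndo_apply_apply V hrel P]

end Isogeny

/-! ## §2 `Ш(φ)` on `M = Ш(E/K)[2^∞]` and the relation `Ш(φ)² = Ш(φ) − 2` -/

section ShaPi

variable {K : Type} [Field K] (V : WeierstrassCurve K)

/-- **`H¹(φ)² = H¹(φ) − 2` on `H¹(K, E)`** for an equivariant endomorphism `φ` of `E(K̄)` with `φ(φP) = φP − 2P` (cmk2's
`resH1Hom_id_rel`: polynomial relations pass to continuous cohomology; `galH1Map φ = resH1Hom id φ`).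
[cite: SerreGaloisCohomology1997, I.§2.4] -/
theorem galH1Map_galH1Map_cmEndo (φ : V.geomPoints →+ V.geomPoints)
    (hφG : ∀ (g : absoluteGaloisGroup K) (P : V.geomPoints), φ (g • P) = g • φ P)
    (hrel : ∀ P, φ (φ P) = φ P - 2 • P) (c : V.galH1) :
    galH1Map φ hφG (galH1Map φ hφG c) = galH1Map φ hφG c - (2 : ℤ) • c := by
  have hrel' : ∀ P : V.geomPoints, φ (φ P) + (-1 : ℤ) • φ P = (-2 : ℤ) • P := fun P ↦ by
    rw [hrel P, neg_smul, one_smul, neg_smul, two_zsmul, two_nsmul]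
    abel
  have h := InertOrderSplittingH1.resH1Hom_id_rel (G := absoluteGaloisGroup K) (M := V.geomPoints) φ hφG (-1) (-2) hrel' c
  change galH1Map φ hφG (galH1Map φ hφG c) + (-1 : ℤ) • galH1Map φ hφG c = (-2 : ℤ) • c at h
  have h2 : galH1Map φ hφG (galH1Map φ hφG c) = (-2 : ℤ) • c - (-1 : ℤ) • galH1Map φ hφG c :=
    eq_sub_of_add_eq h
  rw [h2]
  abel

variable [NumberField K]

/-- **`Ш(φ)` on `M = Ш(E/K)[2^∞]`.** For an endo-isogeny `φ` over `K` with `φ(φP) = φP − 2P` there is an additive `πM : M →+ M`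
lying over `H¹(φ)` (through `M ⊆ Ш ⊆ H¹(K, E)`; it is `Ш(φ)` restricted, `Ш(φ)` by the PROVED local points maps of an isogeny) with
`πM (πM x) = 1 • πM x − 2 • x` — the `ℤ[(1+√−7)/2]`-module structure of `Ш(E/K)[2^∞]` in the integer currency of -w2 g7's
`exists_eigenDecomposition`. Milne, *ADT*, I.§7 (`Ш(f)`); Rubin, LNM 1716, §2. [folklore] -/
theorem exists_shaPi_two (φ : Isogeny V V) (hrel : ∀ P, φ (φ P) = φ P - 2 • P) :
    ∃ πM : AddCommGroup.primaryComponent V.sha 2 →+ AddCommGroup.primaryComponent V.sha 2,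
      (∀ x, (((πM x : AddCommGroup.primaryComponent V.sha 2) : V.sha) : V.galH1) =
        galH1Map φ.toAddMonoidHom φ.equivariant ((x : V.sha) : V.galH1)) ∧
      ∀ x, πM (πM x) = (1 : ℤ) • πM x - (2 : ℤ) • x := by
  haveI : Fact (Nat.Prime 2) := ⟨Nat.prime_two⟩
  set πS : V.sha →+ V.sha := shaMap φ.toAddMonoidHom φ.equivariant φ.hasLocalPointsMaps_toAddMonoidHom with hπS_def
  have hπS : ∀ c : V.sha, ((πS c : V.sha) : V.galH1) = galH1Map φ.toAddMonoidHom φ.equivariant c := fun _ ↦ rfl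
  obtain ⟨πM, hπM⟩ := SylvesterTwoShaOmegaAction.exists_restrict_primaryComponent πS 2
  refine ⟨πM, fun x ↦ by rw [hπM, hπS], fun x ↦ ?_⟩
  apply Subtype.ext; apply Subtype.ext
  simp only [one_smul, AddSubgroupClass.coe_sub, hπM, hπS, AddSubgroupClass.coe_zsmul]
  exact galH1Map_galH1Map_cmEndo V φ.toAddMonoidHom φ.equivariant hrel _

omit [NumberField K] in
/-- `M = G[2^∞]` is `2`-primary in the `ℕ`-power currency of -w2 g7's `exists_eigenDecomposition`. [folklore] -/
theorem exists_two_pow_smul_eq_zero_primaryComponent {G : Type*} [AddCommGroup G]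
    (x : AddCommGroup.primaryComponent G 2) : ∃ k : ℕ, 2 ^ k • x = 0 := by
  obtain ⟨n, hn⟩ := AddCommGroup.mem_primaryComponent.mp x.2
  exact ⟨n, Subtype.ext (by rw [AddSubmonoidClass.coe_nsmul, hn, ZeroMemClass.coe_zero])⟩

end ShaPi

/-! ## §3 A lift `τ` of `σ ∈ Aut(K/ℚ)` acting on `Ш(E_K/K)[2^∞]` by an additive automorphism; anti-commutation with `Ш(φ)` -/

section Conj

variable {K : Type} [Field K] [NumberField K] (W : WeierstrassCurve ℚ)
variable {σ : K ≃ₐ[ℚ] K} {τ : AlgebraicClosure K ≃+* AlgebraicClosure K}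

/-- **`(τ⁻¹)_* ∘ τ_* = id` on `H¹(K, E)`** (`E = W/ℚ`): the composite lift `τ⁻¹ ∘ τ` of `σ⁻¹σ = 1` acts as the trivial lift
(`SylvesterTwoShaConjugation.conjH1Points_trans`, `conjH1Points_eq`, `conjH1Points_one_refl`). [cite: GrossLMS1991, §5 (5.1)] -/
theorem conjH1Points_symm_conjH1Points (hτ : IsLiftOfAut σ τ) (x : (W.baseChange K).galH1) :
    hτ.symm_isLiftOfAut.conjH1Points W (hτ.conjH1Points W x) = x := by
  have key : ∀ {σ' : K ≃ₐ[ℚ] K} (h' : IsLiftOfAut σ' (τ.trans τ.symm)), σ' = 1 →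
      h'.conjH1Points W = AddMonoidHom.id _ := by
    intro σ' h' e
    subst e
    rw [SylvesterTwoShaConjugation.conjH1Points_eq W h' isLiftOfAut_one_refl,
      SylvesterTwoShaConjugation.conjH1Points_one_refl]
  have e := key (hτ.trans hτ.symm_isLiftOfAut) (inv_mul_cancel σ)
  rw [SylvesterTwoShaConjugation.conjH1Points_trans W hτ hτ.symm_isLiftOfAut] at e
  exact DFunLike.congr_fun e x

/-- **`τ_* ∘ (τ⁻¹)_* = id` on `H¹(K, E)`.** [cite: GrossLMS1991, §5 (5.1)] -/
theorem conjH1Points_conjH1Points_symm (hτ : IsLiftOfAut σ τ) (x : (W.baseChange K).galH1) :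
    hτ.conjH1Points W (hτ.symm_isLiftOfAut.conjH1Points W x) = x := by
  have key : ∀ {σ' : K ≃ₐ[ℚ] K} (h' : IsLiftOfAut σ' (τ.symm.trans τ)), σ' = 1 →
      h'.conjH1Points W = AddMonoidHom.id _ := by
    intro σ' h' e
    subst e
    rw [SylvesterTwoShaConjugation.conjH1Points_eq W h' isLiftOfAut_one_refl,
      SylvesterTwoShaConjugation.conjH1Points_one_refl]
  have e := key (hτ.symm_isLiftOfAut.trans hτ) (mul_inv_cancel σ)
  rw [SylvesterTwoShaConjugation.conjH1Points_trans W hτ.symm_isLiftOfAut hτ] at e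
  exact DFunLike.congr_fun e x

/-- **`τ_*` is an additive AUTOMORPHISM of `M = Ш(E_K/K)[2^∞]`** (`E = W/ℚ`, `K` a number field all of whose infinite places are
complex, `τ` a lift of `σ ∈ Aut(K/ℚ)`): `τ_*` maps `Ш` into `Ш` (`SylvesterTwoShaConjugation.conjH1Points_mem_sha`), preserves the
`2`-primary part, and has inverse `(τ⁻¹)_*`. The automorphism `g` lies over `τ_* = IsLiftOfAut.conjH1Points` on `H¹(K, E)`.
[cite: GrossLMS1991, §5 (5.1)] -/
theorem exists_conj_addEquiv_sha_two (hK : ∀ w : InfinitePlace K, w.IsComplex) (hτ : IsLiftOfAut σ τ) :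
    ∃ g : AddCommGroup.primaryComponent (W.baseChange K).sha 2 ≃+ AddCommGroup.primaryComponent (W.baseChange K).sha 2,
      ∀ x, (((g x : AddCommGroup.primaryComponent (W.baseChange K).sha 2) : (W.baseChange K).sha) :
          (W.baseChange K).galH1) = hτ.conjH1Points W ((x : (W.baseChange K).sha) : (W.baseChange K).galH1) := by
  haveI : Fact (Nat.Prime 2) := ⟨Nat.prime_two⟩
  have hτ' := hτ.symm_isLiftOfAut
  -- `τ_*` and `(τ⁻¹)_*` on `Ш`
  let sS : (W.baseChange K).sha →+ (W.baseChange K).sha :=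
    ((hτ.conjH1Points W).comp (W.baseChange K).sha.subtype).codRestrict _
      fun c ↦ SylvesterTwoShaConjugation.conjH1Points_mem_sha W hK hτ c.2
  let sS' : (W.baseChange K).sha →+ (W.baseChange K).sha :=
    ((hτ'.conjH1Points W).comp (W.baseChange K).sha.subtype).codRestrict _
      fun c ↦ SylvesterTwoShaConjugation.conjH1Points_mem_sha W hK hτ' c.2
  have hsS : ∀ c : (W.baseChange K).sha, ((sS c : (W.baseChange K).sha) : (W.baseChange K).galH1) =
      hτ.conjH1Points W c := fun _ ↦ rfl
  have hsS' : ∀ c : (W.baseChange K).sha, ((sS' c : (W.baseChange K).sha) : (W.baseChange K).galH1) =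
      hτ'.conjH1Points W c := fun _ ↦ rfl
  -- restrictions to the `2`-primary component
  obtain ⟨sM, hsM⟩ := SylvesterTwoShaOmegaAction.exists_restrict_primaryComponent sS 2
  obtain ⟨sM', hsM'⟩ := SylvesterTwoShaOmegaAction.exists_restrict_primaryComponent sS' 2
  refine ⟨{ toFun := sM, invFun := sM', map_add' := sM.map_add,
            left_inv := fun x ↦ ?_, right_inv := fun x ↦ ?_ }, fun x ↦ by
    change (((sM x : AddCommGroup.primaryComponent (W.baseChange K).sha 2) : (W.baseChange K).sha) :
      (W.baseChange K).galH1) = _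
    rw [hsM, hsS]⟩
  · apply Subtype.ext; apply Subtype.ext
    rw [hsM', hsS', hsM, hsS]
    exact conjH1Points_symm_conjH1Points W hτ _
  · apply Subtype.ext; apply Subtype.ext
    rw [hsM, hsS, hsM', hsS']
    exact conjH1Points_conjH1Points_symm W hτ _

/-- **Anti-commutation on `H¹(K, E)`**: if `φ (τ Q) = τ Q − τ (φ Q)` on `E(K̄)` (the lift `τ` conjugates the endomorphism `φ` to
`φ̄ = 1 − φ`: complex multiplication is `Gal(K/ℚ)`-SEMIlinear), then `H¹(φ) (τ_* c) = τ_* c − τ_* (H¹(φ) c)` (cmk2 g10's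
`InertOrderSplittingH1.resH1Hom_anti` for the compatible pair `(conjGalCMH, pointsMap)` of `τ_*`).
[cite: SerreGaloisCohomology1997, I.§2.4] [cite: GrossLMS1991, §5 (5.1)] -/
theorem galH1Map_conjH1Points_of_anti (hτ : IsLiftOfAut σ τ)
    (φ : (W.baseChange K).geomPoints →+ (W.baseChange K).geomPoints)
    (hφG : ∀ (g : absoluteGaloisGroup K) (P : (W.baseChange K).geomPoints), φ (g • P) = g • φ P)
    (hanti : ∀ Q, φ (hτ.pointsMap W Q) = hτ.pointsMap W Q - hτ.pointsMap W (φ Q)) (c : (W.baseChange K).galH1) :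
    galH1Map φ hφG (hτ.conjH1Points W c) = hτ.conjH1Points W c - hτ.conjH1Points W (galH1Map φ hφG c) := by
  have hanti' : ∀ Q, φ (hτ.pointsMap W Q) = -hτ.pointsMap W (φ Q) - (-1 : ℤ) • hτ.pointsMap W Q := fun Q ↦ by
    rw [hanti Q, neg_smul, one_smul, sub_neg_eq_add]
    abel
  have h := InertOrderSplittingH1.resH1Hom_anti (G := absoluteGaloisGroup K) (M := (W.baseChange K).geomPoints)
    φ hφG hτ.conjGalCMH (hτ.pointsMap W) (hτ.pointsMap_smul W) (-1) hanti' c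
  change galH1Map φ hφG (hτ.conjH1Points W c) =
    -hτ.conjH1Points W (galH1Map φ hφG c) - (-1 : ℤ) • hτ.conjH1Points W c at h
  rw [h]
  abel

end Conj

/-! ## §4 THE SWAP COUNT on `Ш(E_K/K)[2^∞]` given a conjugating lift -/

section Count

variable {K : Type} [Field K] [NumberField K] (W : WeierstrassCurve ℚ)
variable {σ : K ≃ₐ[ℚ] K} {τ : AlgebraicClosure K ≃+* AlgebraicClosure K}

/-- **THE SWAP COUNT `#Ш(E_K/K)[2^∞] = (#Ш[𝔭^∞])²`, `ord₂ #Ш(E_K/K)[2^∞] = 2·ord₂ #Ш[𝔭^∞] = 2·ord₂ #Ш[𝔭̄^∞]`.**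
`E = W/ℚ`; `K` a number field with all infinite places complex; `φ` an endo-isogeny of `E_K` over `K` with `φ(φP) = φP − 2P`
(the complex multiplication `(1 + √−7)/2`, `K ∋ √−7`; §1); `τ` a lift of some `σ ∈ Aut(K/ℚ)` with `φ (τ Q) = τ Q − τ (φ Q)` on
`E(K̄)` (`τ φ τ⁻¹ = φ̄`; companion file `…CMShaConjugationSwap` supplies it for `K/ℚ` Galois); `r ∈ ℤ₂` ANY root of `X² − X + 2`;
`C = Ш[𝔭^∞]`, `C' = Ш[𝔭̄^∞] ≤ M = Ш(E_K/K)[2^∞]` the subgroups on which `Ш(φ)` acts as `r`, resp. `1 − r`, at every level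
(integer-approximation currency of -w2 g7's `exists_eigenDecomposition`, read on `H¹(K, E)` through `M ⊆ Ш ⊆ H¹`). Then
`#C = #C'`, `#M = (#C)² = (#C')²`, `ord₂ #M = 2·ord₂ #C = 2·ord₂ #C'` — `Nat.card` throughout, NO finiteness of `Ш` assumed (an
infinite `M` reads `0 = 0`). Proof: §2–§3 make `(M, Ш(φ), τ_*)` an instance of this seat's B4 `CMPrimes.natCard_eq_sq_of_antiEquiv`.
[cite: GrossLMS1991, §5 (5.1)] [cite: SilvermanATAEC1994, II §1 Prop. 1.1 and App. A §3 (row D = -7)] -/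
theorem card_sha_two_primary_eq_sq_of_lift (hK : ∀ w : InfinitePlace K, w.IsComplex) (hτ : IsLiftOfAut σ τ)
    (φ : Isogeny (W.baseChange K) (W.baseChange K)) (hrel : ∀ P, φ (φ P) = φ P - 2 • P)
    (hanti : ∀ Q, φ (hτ.pointsMap W Q) = hτ.pointsMap W Q - hτ.pointsMap W (φ Q))
    {r : ℤ_[2]} (hr : r * r = r - 2)
    {C C' : AddSubgroup (AddCommGroup.primaryComponent (W.baseChange K).sha 2)}
    (hC : ∀ x, x ∈ C ↔ ∀ (k : ℕ) (N : ℤ), 2 ^ k • x = 0 →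
      ((N : ℤ_[2]) - r) ∈ (Ideal.span {(2 : ℤ_[2]) ^ k} : Ideal ℤ_[2]) →
        galH1Map φ.toAddMonoidHom φ.equivariant
            (((x : AddCommGroup.primaryComponent (W.baseChange K).sha 2) : (W.baseChange K).sha) : (W.baseChange K).galH1) =
          N • (((x : AddCommGroup.primaryComponent (W.baseChange K).sha 2) : (W.baseChange K).sha) : (W.baseChange K).galH1))
    (hC' : ∀ x, x ∈ C' ↔ ∀ (k : ℕ) (N : ℤ), 2 ^ k • x = 0 →
      ((N : ℤ_[2]) - (1 - r)) ∈ (Ideal.span {(2 : ℤ_[2]) ^ k} : Ideal ℤ_[2]) →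
        galH1Map φ.toAddMonoidHom φ.equivariant
            (((x : AddCommGroup.primaryComponent (W.baseChange K).sha 2) : (W.baseChange K).sha) : (W.baseChange K).galH1) =
          N • (((x : AddCommGroup.primaryComponent (W.baseChange K).sha 2) : (W.baseChange K).sha) : (W.baseChange K).galH1)) :
    Nat.card C = Nat.card C' ∧
      Nat.card (AddCommGroup.primaryComponent (W.baseChange K).sha 2) = Nat.card C ^ 2 ∧
      Nat.card (AddCommGroup.primaryComponent (W.baseChange K).sha 2) = Nat.card C' ^ 2 := by
  haveI : Fact (Nat.Prime 2) := ⟨Nat.prime_two⟩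
  set M := ↥(AddCommGroup.primaryComponent (W.baseChange K).sha 2) with hM_def
  obtain ⟨πM, hπM, hπMrel⟩ := exists_shaPi_two (W.baseChange K) φ hrel
  obtain ⟨g, hg⟩ := exists_conj_addEquiv_sha_two W hK hτ
  -- the roots `r`, `1 − r`
  have hsum : r + (1 - r) = ((1 : ℤ) : ℤ_[2]) := by push_cast; ring
  have hprod : r * (1 - r) = ((2 : ℤ) : ℤ_[2]) := by push_cast; linear_combination -hr
  have hunit : IsUnit (r - (1 - r)) := (two_dvd_or_two_dvd_one_sub_of_root hr).2
  -- membership, read on `M`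
  have hcoe : ∀ (x : M) (N : ℤ), πM x = N • x ↔
      galH1Map φ.toAddMonoidHom φ.equivariant (((x : M) : (W.baseChange K).sha) : (W.baseChange K).galH1) =
        N • (((x : M) : (W.baseChange K).sha) : (W.baseChange K).galH1) := fun x N ↦ by
    rw [← hπM x]
    constructor
    · intro h; rw [h, AddSubgroupClass.coe_zsmul, AddSubgroupClass.coe_zsmul]
    · intro h
      apply Subtype.ext; apply Subtype.ext
      rw [h, AddSubgroupClass.coe_zsmul, AddSubgroupClass.coe_zsmul]
  have hC₁ : ∀ x : M, x ∈ C ↔ ∀ (k : ℕ) (N : ℤ), 2 ^ k • x = 0 →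
      ((N : ℤ_[2]) - r) ∈ (Ideal.span {(2 : ℤ_[2]) ^ k} : Ideal ℤ_[2]) → πM x = N • x := fun x ↦ by
    rw [hC x]
    exact forall_congr' fun k ↦ forall_congr' fun N ↦ forall_congr' fun _ ↦ forall_congr' fun _ ↦ (hcoe x N).symm
  have hC₂ : ∀ x : M, x ∈ C' ↔ ∀ (k : ℕ) (N : ℤ), 2 ^ k • x = 0 →
      ((N : ℤ_[2]) - (1 - r)) ∈ (Ideal.span {(2 : ℤ_[2]) ^ k} : Ideal ℤ_[2]) → πM x = N • x := fun x ↦ by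
    rw [hC' x]
    exact forall_congr' fun k ↦ forall_congr' fun N ↦ forall_congr' fun _ ↦ forall_congr' fun _ ↦ (hcoe x N).symm
  -- anti-commutation on `M`
  have hgM : ∀ x : M, πM (g x) = (1 : ℤ) • g x - g (πM x) := fun x ↦ by
    apply Subtype.ext; apply Subtype.ext
    rw [one_smul, AddSubgroupClass.coe_sub, AddSubgroupClass.coe_sub, hπM, hg, hg, hπM]
    exact galH1Map_conjH1Points_of_anti W hτ φ.toAddMonoidHom φ.equivariant hanti _
  obtain ⟨h1, h2⟩ := natCard_eq_sq_of_antiEquiv (p := 2) exists_two_pow_smul_eq_zero_primaryComponent πM hπMrel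
    hsum hprod hunit hC₁ hC₂ g hgM
  exact ⟨natCard_eigen_eq_of_antiEquiv (p := 2) exists_two_pow_smul_eq_zero_primaryComponent πM hsum hC₁ hC₂ g hgM,
    h1, h2⟩

/-- **`ord₂ #Ш(E_K/K)[2^∞] = 2 · ord₂ #Ш[𝔭^∞] = 2 · ord₂ #Ш[𝔭̄^∞]`** in the setting of `card_sha_two_primary_eq_sq_of_lift` — the
form the road-α bookkeeping consumes (STUB-PLAN `stub_heegnerIndexLowerAtTwo` T3: `ord₂ #Ш(W/K₀)[2^∞] = 2·ord₂ #Ш(W/K₀)[𝔭^∞]`).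
[cite: GrossLMS1991, §5 (5.1)] -/
theorem padicValNat_card_sha_two_primary_eq_two_mul_of_lift (hK : ∀ w : InfinitePlace K, w.IsComplex)
    (hτ : IsLiftOfAut σ τ) (φ : Isogeny (W.baseChange K) (W.baseChange K)) (hrel : ∀ P, φ (φ P) = φ P - 2 • P)
    (hanti : ∀ Q, φ (hτ.pointsMap W Q) = hτ.pointsMap W Q - hτ.pointsMap W (φ Q))
    {r : ℤ_[2]} (hr : r * r = r - 2)
    {C C' : AddSubgroup (AddCommGroup.primaryComponent (W.baseChange K).sha 2)}
    (hC : ∀ x, x ∈ C ↔ ∀ (k : ℕ) (N : ℤ), 2 ^ k • x = 0 →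
      ((N : ℤ_[2]) - r) ∈ (Ideal.span {(2 : ℤ_[2]) ^ k} : Ideal ℤ_[2]) →
        galH1Map φ.toAddMonoidHom φ.equivariant
            (((x : AddCommGroup.primaryComponent (W.baseChange K).sha 2) : (W.baseChange K).sha) : (W.baseChange K).galH1) =
          N • (((x : AddCommGroup.primaryComponent (W.baseChange K).sha 2) : (W.baseChange K).sha) : (W.baseChange K).galH1))
    (hC' : ∀ x, x ∈ C' ↔ ∀ (k : ℕ) (N : ℤ), 2 ^ k • x = 0 →
      ((N : ℤ_[2]) - (1 - r)) ∈ (Ideal.span {(2 : ℤ_[2]) ^ k} : Ideal ℤ_[2]) →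
        galH1Map φ.toAddMonoidHom φ.equivariant
            (((x : AddCommGroup.primaryComponent (W.baseChange K).sha 2) : (W.baseChange K).sha) : (W.baseChange K).galH1) =
          N • (((x : AddCommGroup.primaryComponent (W.baseChange K).sha 2) : (W.baseChange K).sha) : (W.baseChange K).galH1)) :
    padicValNat 2 (Nat.card (AddCommGroup.primaryComponent (W.baseChange K).sha 2)) = 2 * padicValNat 2 (Nat.card C) ∧
      padicValNat 2 (Nat.card (AddCommGroup.primaryComponent (W.baseChange K).sha 2)) = 2 * padicValNat 2 (Nat.card C') := by
  obtain ⟨-, h1, h2⟩ := card_sha_two_primary_eq_sq_of_lift W hK hτ φ hrel hanti hr hC hC'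
  exact ⟨by rw [h1, padicValNat.pow], by rw [h2, padicValNat.pow]⟩

end Count

end Summit.BirchSwinnertonDyer.BirchSwinnertonDyer.Theorems.PrintCf2.CMPrimes

end
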